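import Summits.QuantumFields.YangMills.Theorems.FradkinShenkerFlowPoincareToClustering
import Summits.QuantumFields.YangMills.Theorems.FradkinShenkerFlowFiniteSusceptibilityWeakCouplingSiblingFunnel

/-!
# Crux `FiniteSusceptibilityWeakCoupling` (item stmt-QuantumFields-9442): the heat-bath Poincaré funnel entry

Support file for item stmt-QuantumFields-9442 (route `FradkinShenkerFlow` of `YangMills`, line
`sup-axis-reflection-transfer`). The landed funnel (`…SiblingFunnel.lean`, `…MajorantFunnel.lean`) reduces the
crux to volume-uniform time clustering at every `β ≥ β₁(G, r)`. The route's own support item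
`PoincareToClustering` (stmt-QuantumFields-9444, PROVED: `poincareToClustering_proof`) turns a single-link
heat-bath Poincaré inequality for the torus Wilson measures, with a constant uniform in the volume, into exactly
such clustering. Composing the two makes the functional-inequality form of the weak-coupling infrared input an
attach point of the crux: any route proving a volume-uniform heat-bath Poincaré (hence any log-Sobolev /
spectral-gap-of-the-Glauber-dynamics) inequality at every large `β` closes item 9442 by one modus ponens.

Because the proof of `poincareToClustering_proof` is torus-by-torus (gap + finite speed of propagation of the
discrete-time heat bath on ONE torus, `PoincareClustering.abs_cov_le`), the hypothesis is only needed on the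
large tori `S ≥ S₀(β)`; the finitely many small tori are absorbed by the funnel's pair-dependent volume
threshold. This file records that sharper form:

* `PoincareFunnel.clusteringAt_of_poincareAt` : on ONE torus `(ℤ/(2S+1))⁴`, the heat-bath Poincaré inequality
  with constant `C` gives `|⟨A·τ_{n e₀}B⟩ − ⟨A⟩⟨B⟩| ≤ K(A,B) e^{−n/(4800·max C 1)}` for `n ≤ S`, with `K(A,B)`
  and the rate INDEPENDENT of `S` and `β` (the per-torus content of `poincareToClustering_proof`);
* `PoincareFunnel.timeClustering_of_poincareOnLargeTori` : at fixed `(G, r, β)`, the inequality on all tori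
  `S ≥ S₀` with one constant ⇒ exponential time clustering of every pair on all tori `S ≥ S₀`;
* `finiteSusceptibilityWeakCoupling_of_heatBathPoincareOnLargeTori` : (∀ simple `G` ∀ `r` ∃ `β₁` ∀ `β ≥ β₁`
  ∃ `C, S₀` : heat-bath Poincaré with constant `C` on all tori `S ≥ S₀`) ⇒ crux;
* `finiteSusceptibilityWeakCoupling_of_uniformPoincareEventually` : the same with the hypothesis of the route
  decl `PoincareToClustering` verbatim (all tori) at every `β ≥ β₁(G, r)` ⇒ crux;
* `stub_cruxOfHeatBathPoincare` : the registered sub-goal of the item (signature spelled out).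

All statements hold for every compact `G`; simplicity is only carried through the hypotheses. No definition is
introduced. Mathematics: Martinelli 1999 §3–4 / Liggett 2005 Ch. I as landed in `…PoincareToClustering*.lean`,
plus the RP funnel.
-/

noncomputable section

open MeasureTheory ProbabilityTheory
open Literature.MathematicalPhysics.QuantumFieldTheory Literature.MathematicalPhysics.QuantumLattice

namespace Summit.QuantumFields.YangMills.Theorems.FiniteSusceptibilityWeakCoupling

namespace PoincareFunnel

open Summit.QuantumFields.YangMills.Theorems.PoincareClustering

variable {G : Type} [Group G] [TopologicalSpace G] [IsTopologicalGroup G] [CompactSpace G]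
  [MeasurableSpace G] [BorelSpace G]

/-- **Per-torus clustering from the per-torus heat-bath Poincaré inequality.** On the torus
`(ℤ/(2S+1))⁴`, if the Wilson measure at coupling `β` satisfies the single-link heat-bath Poincaré inequality
with constant `C` for all bounded measurable `F`, then for all bounded gauge-invariant local `A, B` (bounds
`M_A, M_B`) and `n ≤ S`,
`|⟨A·τ_{n e₀}B⟩ − ⟨A⟩⟨B⟩| ≤ (4 M_A M_B + 8 |supp A| M_A M_B e^{R_A + R_B}) · exp(−n / (4 · max C 1 · 1200))`,
`R_X = max time-coordinate modulus over supp X`. The constant and the rate do not depend on `S` or `β`: this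
is the body of `poincareToClustering_proof` with the volume held fixed (Martinelli 1999 §3–4). [folklore] -/
theorem clusteringAt_of_poincareAt (r : LatticeRep G) (β : ℝ) {C : ℝ} {S : ℕ}
    (hCS : ∀ F : GaugeConfig 4 (2 * S + 1) G → ℝ, Measurable F → (∃ M : ℝ, ∀ U, |F U| ≤ M) →
      variance F (wilsonMeasure (d := 4) (L := 2 * S + 1) r.ρ β) ≤
        C * ∑ ℓ : Edge 4 (2 * S + 1), ∫ U, ∫ g, (F U - F (Function.update U ℓ g)) ^ 2
          ∂(hbLaw r.ρ β ℓ U) ∂(wilsonMeasure (d := 4) (L := 2 * S + 1) r.ρ β))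
    (A B : YMSpecies G) {MA MB : ℝ} (hMA : ∀ U, |A.F U| ≤ MA) (hMB : ∀ U, |B.F U| ≤ MB)
    {n : ℕ} (hn : n ≤ S) :
    |latticeConnectedCorr r.ρ β (2 * S + 1) A.F B.F n| ≤
      (4 * MA * MB + 8 * A.supp.card * MA * MB *
          Real.exp (((A.supp.sup fun e => (e.1 0).natAbs : ℕ) : ℝ) +
            ((B.supp.sup fun e => (e.1 0).natAbs : ℕ) : ℝ))) *
        Real.exp (-(1 / (4 * max C 1 * 1200) * n)) := by
  haveI : SecondCountableTopology G :=
    (r.continuous.isClosedEmbedding r.injective).isEmbedding.secondCountableTopology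
  have hC'1 : (1 : ℝ) ≤ max C 1 := le_max_right _ _
  have hC'0 : (0 : ℝ) < max C 1 := by positivity
  have hMA0 : 0 ≤ MA := (abs_nonneg _).trans (hMA 1)
  have hMB0 : 0 ≤ MB := (abs_nonneg _).trans (hMB 1)
  -- the Poincaré inequality on the torus of side `2S+1`, constant `max C 1`
  have hP : ∀ F : GaugeConfig 4 (2 * S + 1) G → ℝ, Measurable F → (∃ M : ℝ, ∀ U, |F U| ≤ M) →
      variance F (wilsonMeasure (d := 4) (L := 2 * S + 1) r.ρ β) ≤
        max C 1 * ∑ ℓ : Edge 4 (2 * S + 1), ∫ U, ∫ g, (F U - F (Function.update U ℓ g)) ^ 2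
          ∂(hbLaw r.ρ β ℓ U) ∂(wilsonMeasure (d := 4) (L := 2 * S + 1) r.ρ β) := by
    intro F hF hb
    refine (hCS F hF hb).trans (mul_le_mul_of_nonneg_right (le_max_left _ _) ?_)
    exact Finset.sum_nonneg fun ℓ _ => integral_nonneg fun U => integral_nonneg fun g => sq_nonneg _
  -- the two observables on the torus
  have hfm : Measurable fun U : GaugeConfig 4 (2 * S + 1) G => A.F (torusLift (2 * S + 1) U) :=
    A.measurable.comp (measurable_torusLift _)
  have hgm : Measurable fun U : GaugeConfig 4 (2 * S + 1) G =>
      B.F (configShift (-Pi.single (0 : Fin 4) (n : ℤ)) (torusLift (2 * S + 1) U)) :=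
    B.measurable.comp ((configShift _).measurable.comp (measurable_torusLift _))
  have hfb : ∀ U : GaugeConfig 4 (2 * S + 1) G, |A.F (torusLift (2 * S + 1) U)| ≤ MA :=
    fun U => hMA _
  have hgb : ∀ U : GaugeConfig 4 (2 * S + 1) G,
      |B.F (configShift (-Pi.single (0 : Fin 4) (n : ℤ)) (torusLift (2 * S + 1) U))| ≤ MB :=
    fun U => hMB _
  -- supports and time distances
  have hTf : ∀ ℓ, ℓ ∉ A.supp.image (torusEdge (2 * S + 1)) → ∀ (U : GaugeConfig 4 (2 * S + 1) G)
      (g' : G), A.F (torusLift (2 * S + 1) (Function.update U ℓ g')) = A.F (torusLift (2 * S + 1) U) :=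
    fun ℓ hℓ U g' => apply_torusLift_update A hℓ U g'
  have hfar : ∀ ℓ ∈ A.supp.image (torusEdge (2 * S + 1)),
      n - A.supp.sup (fun e => (e.1 0).natAbs) ≤ tdist (n : ZMod (2 * S + 1)) ℓ :=
    fun ℓ hℓ => sub_le_tdist_of_mem_image A hn hℓ
  -- oscillations of `g`: weight `a = e⁻¹`, amplitude `2 M_B e^{R_B}`
  have ha0 : (0 : ℝ) < Real.exp (-1) := Real.exp_pos _
  have ha1 : Real.exp (-1) ≤ 1 := by rw [Real.exp_le_one_iff]; norm_num
  have hgo : ∀ ℓ : Edge 4 (2 * S + 1), osc (fun U : GaugeConfig 4 (2 * S + 1) G =>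
      B.F (configShift (-Pi.single (0 : Fin 4) (n : ℤ)) (torusLift (2 * S + 1) U))) ℓ ≤
      (2 * MB * Real.exp ((B.supp.sup fun e => (e.1 0).natAbs : ℕ) : ℝ)) *
        Real.exp (-1) ^ tdist (n : ZMod (2 * S + 1)) ℓ := by
    intro ℓ
    refine (osc_configShift_torusLift_le B _ hMB ℓ).trans ?_
    split_ifs with hmem
    · have ht : (tdist (n : ZMod (2 * S + 1)) ℓ : ℝ) ≤ ((B.supp.sup fun e => (e.1 0).natAbs : ℕ) : ℝ) := by
        exact_mod_cast tdist_le_of_mem_image_shift B n hmem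
      have h1 : (1 : ℝ) ≤ Real.exp ((B.supp.sup fun e => (e.1 0).natAbs : ℕ) : ℝ) *
          Real.exp (-1) ^ tdist (n : ZMod (2 * S + 1)) ℓ := by
        rw [← Real.exp_nat_mul, ← Real.exp_add]
        exact Real.one_le_exp (by linarith)
      calc MB + MB = 2 * MB * 1 := by ring
        _ ≤ 2 * MB * (Real.exp ((B.supp.sup fun e => (e.1 0).natAbs : ℕ) : ℝ) *
            Real.exp (-1) ^ tdist (n : ZMod (2 * S + 1)) ℓ) :=
            mul_le_mul_of_nonneg_left h1 (by positivity)
        _ = _ := by ring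
    · positivity
  -- the one-torus bound with Glauber time `k = n / 1200`
  have key := abs_cov_le (d := 4) (L := 2 * S + 1) r.ρ β r.continuous hC'1 hP hfm hgm hfb hgb
    (A.supp.image (torusEdge (2 * S + 1))) hTf (n : ZMod (2 * S + 1))
    (n - A.supp.sup fun e => (e.1 0).natAbs) hfar ha0 ha1 (by positivity) hgo (n / 1200)
  have hcard : ((A.supp.image (torusEdge (2 * S + 1))).card : ℝ) ≤ A.supp.card := by
    exact_mod_cast Finset.card_image_le
  have hT1 := gapTerm_le hC'1 n
  have hT2 := coneTerm_le hC'1 n (A.supp.sup fun e => (e.1 0).natAbs)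
  have hE : 0 ≤ Real.exp (-(1 / (4 * max C 1 * 1200) * n)) := (Real.exp_pos _).le
  -- translation invariance of the torus Wilson state: `⟨B ∘ τ⟩ = ⟨B⟩`
  have hmean : ∫ U, B.F (configShift (-Pi.single (0 : Fin 4) (n : ℤ)) (torusLift (2 * S + 1) U))
      ∂(wilsonMeasure (d := 4) (L := 2 * S + 1) r.ρ β) =
      ∫ U, B.F (torusLift (2 * S + 1) U) ∂(wilsonMeasure (d := 4) (L := 2 * S + 1) r.ρ β) := by
    have h := wilsonExpectation_comp_torusConfigShift (d := 4) (L := 2 * S + 1) r.ρ β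
      (Literature.Probability.LatticeModels.Torus.proj (2 * S + 1) (-Pi.single (0 : Fin 4) (n : ℤ)))
      (toTorusObservable (2 * S + 1) B.F)
    rw [← toTorusObservable_comp_configShift] at h
    exact h
  unfold latticeConnectedCorr
  rw [← hmean]
  refine key.trans ?_
  calc 2 * MA * MB * Real.exp (-(((n / 1200 : ℕ) : ℝ) / (4 * max C 1))) +
        ((n / 1200 : ℕ) : ℝ) * ((A.supp.image (torusEdge (2 * S + 1))).card : ℝ) * MA *
          (2 * MB * Real.exp ((B.supp.sup fun e => (e.1 0).natAbs : ℕ) : ℝ) *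
            Real.exp (2 * ((4 + 1) * (4 + 4 * 4) : ℕ) / Real.exp (-1) * ((n / 1200 : ℕ) : ℝ))) *
          Real.exp (-1) ^ (n - A.supp.sup fun e => (e.1 0).natAbs)
      = 2 * MA * MB * Real.exp (-(((n / 1200 : ℕ) : ℝ) / (4 * max C 1))) +
        2 * ((A.supp.image (torusEdge (2 * S + 1))).card : ℝ) * MA * MB *
          Real.exp ((B.supp.sup fun e => (e.1 0).natAbs : ℕ) : ℝ) *
          (((n / 1200 : ℕ) : ℝ) * (Real.exp (2 * ((4 + 1) * (4 + 4 * 4) : ℕ) / Real.exp (-1) *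
            ((n / 1200 : ℕ) : ℝ)) * Real.exp (-1) ^ (n - A.supp.sup fun e => (e.1 0).natAbs))) := by
          ring
    _ ≤ 2 * MA * MB * (2 * Real.exp (-(1 / (4 * max C 1 * 1200) * n))) +
        2 * (A.supp.card : ℝ) * MA * MB * Real.exp ((B.supp.sup fun e => (e.1 0).natAbs : ℕ) : ℝ) *
          (4 * Real.exp ((A.supp.sup fun e => (e.1 0).natAbs : ℕ) : ℝ) *
            Real.exp (-(1 / (4 * max C 1 * 1200) * n))) := by
          gcongr
    _ = (4 * MA * MB + 8 * A.supp.card * MA * MB *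
          Real.exp (((A.supp.sup fun e => (e.1 0).natAbs : ℕ) : ℝ) + ((B.supp.sup fun e => (e.1 0).natAbs : ℕ) : ℝ))) *
        Real.exp (-(1 / (4 * max C 1 * 1200) * n)) := by
          rw [Real.exp_add]
          ring

/-- **Heat-bath Poincaré on the large tori ⇒ time clustering on the large tori, at fixed `(G, r, β)`.** If the
torus Wilson measures at coupling `β` satisfy the single-link heat-bath Poincaré inequality with ONE constant `C`
on every torus `(ℤ/(2S+1))⁴` with `S ≥ S₀`, then there is `m > 0` (namely `1/(4800·max C 1)`) such that every
pair of bounded gauge-invariant local observables clusters exponentially in Euclidean time at rate `m` on all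
tori `S ≥ S₀`, `n ≤ S`, with a pair-dependent constant — the `TimeClusteringEventually` shape consumed by the
funnel. [folklore] -/
theorem timeClustering_of_poincareOnLargeTori (r : LatticeRep G) (β : ℝ) {C : ℝ} {S₀ : ℕ}
    (hC : ∀ S : ℕ, S₀ ≤ S → ∀ F : GaugeConfig 4 (2 * S + 1) G → ℝ, Measurable F →
      (∃ M : ℝ, ∀ U, |F U| ≤ M) →
      variance F (wilsonMeasure (d := 4) (L := 2 * S + 1) r.ρ β) ≤
        C * ∑ ℓ : Edge 4 (2 * S + 1), ∫ U, ∫ g, (F U - F (Function.update U ℓ g)) ^ 2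
          ∂((haarProbability G).tilted fun g' => -β * wilsonAction r.ρ (Function.update U ℓ g'))
          ∂(wilsonMeasure (d := 4) (L := 2 * S + 1) r.ρ β)) :
    ∃ m : ℝ, 0 < m ∧ ∀ A B : YMSpecies G, ∃ (K : ℝ) (S₁ : ℕ), ∀ S : ℕ, S₁ ≤ S → ∀ n : ℕ, n ≤ S →
      |latticeConnectedCorr r.ρ β (2 * S + 1) A.F B.F n| ≤ K * Real.exp (-(m * n)) := by
  have hC'0 : (0 : ℝ) < max C 1 := lt_of_lt_of_le one_pos (le_max_right _ _)
  refine ⟨1 / (4 * max C 1 * 1200), by positivity, fun A B => ?_⟩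
  obtain ⟨MA, hMA⟩ := A.bounded
  obtain ⟨MB, hMB⟩ := B.bounded
  exact ⟨4 * MA * MB + 8 * A.supp.card * MA * MB *
      Real.exp (((A.supp.sup fun e => (e.1 0).natAbs : ℕ) : ℝ) + ((B.supp.sup fun e => (e.1 0).natAbs : ℕ) : ℝ)),
    S₀, fun S hS n hn => clusteringAt_of_poincareAt r β (hC S hS) A B hMA hMB hn⟩

end PoincareFunnel

open PoincareFunnel

/-- **Heat-bath Poincaré on the large tori, eventually in `β` ⇒ crux.** If for every compact simple `G` and
lattice representation `r` there is `β₁` such that at every `β ≥ β₁` the torus Wilson measures satisfy the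
single-link heat-bath Poincaré inequality `Var(F) ≤ C(β) Σ_ℓ ∫∫ (F(U) − F(U[ℓ ↦ g]))² dν_ℓ^U dμ` for all
bounded measurable `F`, with one constant on all tori `(ℤ/(2S+1))⁴`, `S ≥ S₀(β)`, then
`FiniteSusceptibilityWeakCoupling` holds: Poincaré ⇒ exponential time clustering on the large tori
(`timeClustering_of_poincareOnLargeTori`) ⇒ cubic moments ⇒ crux (the landed RP funnel). -/
theorem finiteSusceptibilityWeakCoupling_of_heatBathPoincareOnLargeTori
    (h : ∀ (G : Type) [Group G] [TopologicalSpace G] [IsTopologicalGroup G] [CompactSpace G]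
      [MeasurableSpace G] [BorelSpace G], IsCompactSimpleLieGroup G → ∀ (r : LatticeRep G),
      ∃ β₁ : ℝ, ∀ β : ℝ, β₁ ≤ β → ∃ (C : ℝ) (S₀ : ℕ), ∀ S : ℕ, S₀ ≤ S →
        ∀ F : GaugeConfig 4 (2 * S + 1) G → ℝ, Measurable F → (∃ M : ℝ, ∀ U, |F U| ≤ M) →
          variance F (wilsonMeasure (d := 4) (L := 2 * S + 1) r.ρ β) ≤
            C * ∑ ℓ : Edge 4 (2 * S + 1), ∫ U, ∫ g, (F U - F (Function.update U ℓ g)) ^ 2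
              ∂((haarProbability G).tilted fun g' => -β * wilsonAction r.ρ (Function.update U ℓ g'))
              ∂(wilsonMeasure (d := 4) (L := 2 * S + 1) r.ρ β)) :
    Summit.QuantumFields.YangMills.Theses.FradkinShenkerFlow.FiniteSusceptibilityWeakCoupling := by
  refine finiteSusceptibilityWeakCoupling_of_timeClusteringEventually fun G _ _ _ _ _ _ hG r => ?_
  obtain ⟨β₁, hβ₁⟩ := h G hG r
  refine ⟨β₁, fun β hβ => ?_⟩
  obtain ⟨C, S₀, hC⟩ := hβ₁ β hβ
  exact timeClustering_of_poincareOnLargeTori r β hC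

/-- **Uniform heat-bath Poincaré (the hypothesis of the route decl `PoincareToClustering`, verbatim), eventually
in `β` ⇒ crux.** If for every compact simple `G` and lattice representation `r` there is `β₁` such that at
every `β ≥ β₁` the antecedent `UP(β)` of `FradkinShenkerFlow.PoincareToClustering` holds (one constant, all
tori), then `FiniteSusceptibilityWeakCoupling` holds — through the route's PROVED support item
`poincareToClustering_proof` (stmt-QuantumFields-9444) and the landed time-clustering funnel. -/
theorem finiteSusceptibilityWeakCoupling_of_uniformPoincareEventually
    (h : ∀ (G : Type) [Group G] [TopologicalSpace G] [IsTopologicalGroup G] [CompactSpace G]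
      [MeasurableSpace G] [BorelSpace G], IsCompactSimpleLieGroup G → ∀ (r : LatticeRep G),
      ∃ β₁ : ℝ, ∀ β : ℝ, β₁ ≤ β → ∃ C : ℝ, ∀ S : ℕ,
        ∀ F : GaugeConfig 4 (2 * S + 1) G → ℝ, Measurable F → (∃ M : ℝ, ∀ U, |F U| ≤ M) →
          variance F (wilsonMeasure (d := 4) (L := 2 * S + 1) r.ρ β) ≤
            C * ∑ ℓ : Edge 4 (2 * S + 1), ∫ U, ∫ g, (F U - F (Function.update U ℓ g)) ^ 2
              ∂((haarProbability G).tilted fun g' => -β * wilsonAction r.ρ (Function.update U ℓ g'))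
              ∂(wilsonMeasure (d := 4) (L := 2 * S + 1) r.ρ β)) :
    Summit.QuantumFields.YangMills.Theses.FradkinShenkerFlow.FiniteSusceptibilityWeakCoupling := by
  refine finiteSusceptibilityWeakCoupling_of_heatBathPoincareOnLargeTori fun G _ _ _ _ _ _ hG r => ?_
  obtain ⟨β₁, hβ₁⟩ := h G hG r
  refine ⟨β₁, fun β hβ => ?_⟩
  obtain ⟨C, hC⟩ := hβ₁ β hβ
  exact ⟨C, 0, fun S _ => hC S⟩

/-- **`PoincareToClustering`'s antecedent at weak coupling ⇒ crux, as a registered sub-goal of the item**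
(`stub_cruxOfHeatBathPoincare`; signature spelled out): a volume-uniform single-link heat-bath Poincaré
inequality for the four-dimensional torus Wilson measures at every `β ≥ β₁(G, r)`, on all tori `S ≥ S₀(β)`,
implies `FiniteSusceptibilityWeakCoupling`. -/
theorem stub_cruxOfHeatBathPoincare : (∀ (G : Type) [Group G] [TopologicalSpace G] [IsTopologicalGroup G] [CompactSpace G] [MeasurableSpace G] [BorelSpace G], Literature.MathematicalPhysics.QuantumFieldTheory.IsCompactSimpleLieGroup G → ∀ (r : Literature.MathematicalPhysics.QuantumFieldTheory.LatticeRep G), ∃ β₁ : ℝ, ∀ β : ℝ, β₁ ≤ β → ∃ (C : ℝ) (S₀ : ℕ), ∀ S : ℕ, S₀ ≤ S → ∀ F : Literature.MathematicalPhysics.QuantumFieldTheory.GaugeConfig 4 (2 * S + 1) G → ℝ, Measurable F → (∃ M : ℝ, ∀ U, |F U| ≤ M) → ProbabilityTheory.variance F (Literature.MathematicalPhysics.QuantumFieldTheory.wilsonMeasure (d := 4) (L := 2 * S + 1) r.ρ β) ≤ C * ∑ ℓ : Literature.MathematicalPhysics.QuantumFieldTheory.Edge 4 (2 * S + 1), ∫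 U, ∫ g, (F U - F (Function.update U ℓ g)) ^ 2 ∂((Literature.MathematicalPhysics.QuantumFieldTheory.haarProbability G).tilted (fun g' => -β * Literature.MathematicalPhysics.QuantumFieldTheory.wilsonAction r.ρ (Function.update U ℓ g'))) ∂(Literature.MathematicalPhysics.QuantumFieldTheory.wilsonMeasure (d := 4) (L := 2 * S + 1) r.ρ β)) → Summit.QuantumFields.YangMills.Theses.FradkinShenkerFlow.FiniteSusceptibilityWeakCoupling :=
  finiteSusceptibilityWeakCoupling_of_heatBathPoincareOnLargeTori

end Summit.QuantumFields.YangMills.Theorems.FiniteSusceptibilityWeakCoupling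

end
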